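import Mathlib
import HarnessLib
import Summits.NavierStokesRegularity.NavierStokesRegularity.Theorems.PoloidalWindowDoorLrcModEntireShearedKinematics

/-!
# Route `PoloidalWindowDoor`, item `LrcModEntire` (stmt-NavierStokesRegularity-20428), cell (Q4-sonic), slot `stub_Q4sonicLineNeg`, case I —
# THE (TH) SLOPE `μ(t,z)` IS SMOOTH WHEREVER SOME HORIZONTAL DERIVATIVE OF `U₂` IS NON-ZERO ON THE PLANE

Cell ns-regularity-ideate, helper seat ns-k2-port-2 g8 under the LEAD of item 20428 (ns-poloidal-K2-p3 g17; my flag of 20:07Z / memo HOT-SHEET-port2g8 v5 §6: the B-CK2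
toolkit `…SheetSystemUniqueness` / `…SheetSystemMixed` wants `C^∞` coefficients on the tube, while the registry literal only gives `hμ3 : ContDiff ℝ 3 (uncurry μ)`);
`--supports stmt-NavierStokesRegularity-20428 --as helper`.  Class-free.

* ★ `slope_contDiffAt_of_horizDeriv_ne_zero` — `uncurry U ∈ C^∞(T × ℝ³)` (`T` open), the slab law `∂_zU_b(t,x) = μ(t,x₂)·∂_bU₂(t,x)` (`b = 0,1`) for `t ∈ T`,
  `|x₂| < ρ`; if at some `(t₀, x₀)` with `t₀ ∈ T`, `|x₀₂| < ρ` a horizontal derivative `∂_bU₂(t₀,x₀) ≠ 0`, then **`uncurry μ` is `C^∞` at `(t₀, x₀₂)`**: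
  near `(t₀, x₀₂)` the slope is the quotient `μ(t,z) = ∂_zU_b(t, x₀ + (z − x₀₂)e₂) / ∂_bU₂(t, x₀ + (z − x₀₂)e₂)` of two smooth functions.
On the web window of case I the hypothesis holds at every height (the ridge curvature `D²U₂[Je,Je] ≠ 0` at web points forces `∂_{Je}U₂ ≠ 0` nearby on the same
plane), so the `μ`-coefficients `μ_z, μ_zz, μ_t` of the rows `…ShearedVerticalRow.verticalRow_template` are `C^∞` on a small tube, as the template needs.
WHAT THIS IS NOT: not a claim about Navier–Stokes regularity; no stub is closed here; items 20428 / 19708 / 27893 OPEN.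
-/

noncomputable section

set_option linter.dupNamespace false
set_option linter.style.longLine false

namespace Summit.NavierStokesRegularity.NavierStokesRegularity.Theorems.PoloidalWindowDoorLrcModEntireSlopeSmooth

open Set Function Filter Topology
open scoped ContDiff
open Summit.NavierStokesRegularity.NavierStokesRegularity.Theorems.PoloidalWindowDoorLrcModEntireShearedKinematics

/-- ★ **The (TH) slope is `C^∞` at `(t₀, x₀₂)` if some horizontal derivative of `U₂` is non-zero at `(t₀, x₀)`.** -/
theorem slope_contDiffAt_of_horizDeriv_ne_zero {U : ℝ → E3 → E3} {T : Set ℝ} (hT : IsOpen T)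
    (hU : ContDiffOn ℝ ∞ (uncurry U) (T ×ˢ (univ : Set E3))) {μ : ℝ → ℝ → ℝ} {ρ : ℝ}
    (hslab : ∀ t ∈ T, ∀ x : E3, |x 2| < ρ → ∀ b : Fin 3, b ≠ 2 →
      fderiv ℝ (U t) x (EuclideanSpace.single 2 1) b = μ t (x 2) * fderiv ℝ (U t) x (EuclideanSpace.single b 1) 2)
    {t₀ : ℝ} (ht₀ : t₀ ∈ T) {x₀ : E3} (hx₀ : |x₀ 2| < ρ) {b : Fin 3} (hb : b ≠ 2)
    (hgrad : fderiv ℝ (U t₀) x₀ (EuclideanSpace.single b 1) 2 ≠ 0) :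
    ContDiffAt ℝ ∞ (uncurry μ) (t₀, x₀ 2) := by
  set E2 : E3 := EuclideanSpace.single 2 (1 : ℝ) with hE2
  set Eb : E3 := EuclideanSpace.single b (1 : ℝ) with hEb
  -- the vertical line of base points `X(t,z) = (t, x₀ + (z − x₀₂)·e₂)`, with `X(t,z)₂ = z`
  set X : ℝ × ℝ → ℝ × E3 := fun q => (q.1, x₀ + (q.2 - x₀ 2) • E2) with hX
  have hXs : ContDiff ℝ ∞ X :=
    contDiff_fst.prodMk (contDiff_const.add ((contDiff_snd.sub contDiff_const).smul contDiff_const))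
  have hX2 : ∀ q : ℝ × ℝ, (X q).2 2 = q.2 := fun q => by simp [hX, hE2]
  have hX0 : X (t₀, x₀ 2) = (t₀, x₀) := by simp [hX]
  -- numerator and denominator as smooth functions of `(t,z)`
  set N : ℝ × ℝ → ℝ := fun q => fderiv ℝ (uncurry U) (X q) ((0 : ℝ), E2) b with hN
  set Dn : ℝ × ℝ → ℝ := fun q => fderiv ℝ (uncurry U) (X q) ((0 : ℝ), Eb) 2 with hDn
  have hDU : ContDiffOn ℝ ∞ (fderiv ℝ (uncurry U)) (T ×ˢ (univ : Set E3)) := hU.fderiv_of_isOpen (hT.prod isOpen_univ) (by simp)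
  have hmemX : ∀ᶠ q in 𝓝 ((t₀, x₀ 2) : ℝ × ℝ), (X q).1 ∈ T := by
    have h1 : ∀ᶠ q in 𝓝 ((t₀, x₀ 2) : ℝ × ℝ), q.1 ∈ T := continuous_fst.continuousAt.preimage_mem_nhds (hT.mem_nhds ht₀)
    filter_upwards [h1] with q hq using hq
  have hDUX : ContDiffAt ℝ ∞ (fun q => fderiv ℝ (uncurry U) (X q)) (t₀, x₀ 2) := by
    have hq0 : X (t₀, x₀ 2) ∈ T ×ˢ (univ : Set E3) := by rw [hX0]; exact ⟨ht₀, mem_univ _⟩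
    exact (hDU.contDiffAt ((hT.prod isOpen_univ).mem_nhds hq0)).comp _ hXs.contDiffAt
  have hNs : ContDiffAt ℝ ∞ N (t₀, x₀ 2) := by
    have h := hDUX.clm_apply contDiffAt_const (g := fun _ => (((0 : ℝ), E2) : ℝ × E3))
    exact (EuclideanSpace.proj (𝕜 := ℝ) b).contDiff.contDiffAt.comp _ h
  have hDns : ContDiffAt ℝ ∞ Dn (t₀, x₀ 2) := by
    have h := hDUX.clm_apply contDiffAt_const (g := fun _ => (((0 : ℝ), Eb) : ℝ × E3))
    exact (EuclideanSpace.proj (𝕜 := ℝ) (2 : Fin 3)).contDiff.contDiffAt.comp _ h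
  -- slice derivatives are joint derivatives in spatial directions
  have hslice : ∀ q : ℝ × ℝ, q.1 ∈ T → ∀ v : E3, fderiv ℝ (U q.1) (X q).2 v = fderiv ℝ (uncurry U) (X q) ((0 : ℝ), v) := by
    intro q hq v
    have hW : DifferentiableAt ℝ (uncurry U) ((X q).1, (X q).2) := (regular_at hT hU (q := X q) hq).2.1
    have h := fderiv_slice_eq (W := uncurry U) hW v
    exact h
  -- the denominator does not vanish at `(t₀, x₀₂)`, hence nearby
  have hDn0 : Dn (t₀, x₀ 2) ≠ 0 := by
    have h := hslice (t₀, x₀ 2) ht₀ Eb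
    rw [hX0] at h
    simp only [hDn, hX0]
    rw [← h]; exact hgrad
  have hDnz : ∀ᶠ q in 𝓝 ((t₀, x₀ 2) : ℝ × ℝ), Dn q ≠ 0 := hDns.continuousAt.eventually_ne hDn0
  have hzρ : ∀ᶠ q in 𝓝 ((t₀, x₀ 2) : ℝ × ℝ), |q.2| < ρ :=
    (continuous_abs.comp continuous_snd).continuousAt.eventually_lt_const ?_ |>.mono fun q hq => hq
  swap; · simpa using hx₀
  -- `μ = N / Dn` near `(t₀, x₀₂)`
  have hμeq : uncurry μ =ᶠ[𝓝 ((t₀, x₀ 2) : ℝ × ℝ)] fun q => N q / Dn q := by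
    filter_upwards [hmemX, hDnz, hzρ] with q hqT hqD hqz
    have hlaw := hslab q.1 hqT (X q).2 (by rw [hX2]; exact hqz) b hb
    rw [hX2, hslice q hqT, hslice q hqT, ← hEb] at hlaw
    have hqD' : fderiv ℝ (uncurry U) (X q) ((0 : ℝ), Eb) 2 ≠ 0 := by simpa only [hDn] using hqD
    simp only [uncurry, hN, hDn]
    rw [eq_div_iff hqD']
    exact hlaw.symm
  exact (hNs.div hDns hDn0).congr_of_eventuallyEq hμeq

end Summit.NavierStokesRegularity.NavierStokesRegularity.Theorems.PoloidalWindowDoorLrcModEntireSlopeSmooth
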